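import Summits.SmoothPoincare4.SmoothPoincare4.Theorems.SblfDescentRungOneStubSliceRecognitionAux1
import Summits.SmoothPoincare4.SmoothPoincare4.Theorems.SblfDescentRungOneStubSliceRecognitionAux2
import Literature.Topology.FourManifolds.GluingIsotopyProofs

/-!
# Four-sphere recognition from a slice-preserving genus-one gluing, V: a circle of isometries
# extends over the polar tube; re-gluing the level sphere — helpers for stub
# `stub_sliceRecognition` of line `Sketch`, crux `SblfDescent.RungOne`

(Crux item stmt-SmoothPoincare4-18531; skeleton `Cruxes/RungOne/Lines/Sketch.lean`.)

The polar tube `V₀ = {x ∈ S | x₃² + x₄² ≥ 1/2}` of the level sphere `S = {Σ xᵢ² = 1} ⊆ ℝ⁵` is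
`B³ × S¹` in the coordinates `y = (x₀, x₁, x₂)` (`|y|² ≤ 1/2`) and `w = (x₃, x₄) ≠ 0`.  A smooth
loop `A` of linear isometries of `ℝ³`, trivial near the base point of the circle (`A(a) = 1` for
`a ∉ (1/4, 3/4)`, `a` the angle `angA` of `w/|w|`), and an isometry `L`, act on `V₀` by
`Θ(y, w) = (L⁻¹ A(a)⁻¹ y, w)` — a LINEAR map in `y`, so it is defined on the whole ball, smooth
(descent to the circle, part II `contMDiff_comp_angA`; smoothness into the regular domain `V₀`,
Lee 2013, Cor. 5.30, part I), a diffeomorphism (inverse `(A(a) L y, w)`), preserving the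
boundary `{x₃² + x₄² = 1/2}`, on which it restricts to the inverse of the suspension of the
circle-family `u ↦ A(angA u) ∘ L|S²`.

* `helper_sliceRec_reglue` (registered helper) — **re-gluing the level sphere** (Hirsch 1976,
  Ch. 8 §2, Thm. 2.2, the tree's `IsBoundaryGluing.comp_diffeomorph_right`): since
  `S = W₀ ∪_{id} V₀` (`SphereFourSplitting.isBoundaryGluing_levelSphere`) and `Θ ∈ Diff(V₀)`
  restricts on `∂V₀` to `ψ` with `ψ ∘ χ = id` for the suspension `χ : ∂W₀ ≅ ∂V₀` of
  `u ↦ A(angA u) ∘ L|S²`, the level sphere is also the gluing `W₀ ∪_χ V₀`.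

Everything is proved; no definitions, no named facts, no local notation.

## References

* M. W. Hirsch, *Differential Topology*, GTM 33 (1976), Ch. 8 §2, Thm. 2.2. [HirschDT1976]
* H. Gluck, *The embedding of two-spheres in the four-sphere*, Trans. AMS 104 (1962) 308–333,
  §5 (diffeomorphisms of `S² × S¹`; the rotation loop extends over `B³ × S¹`).
* J. M. Lee, *Introduction to Smooth Manifolds* (2013), Cor. 5.30. [LeeSmoothManifolds2013]
-/

-- the prescribed namespace `Summit.<P>.<Sub>.…` duplicates `SmoothPoincare4` (P = Sub)
set_option linter.dupNamespace false

noncomputable section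

open scoped Manifold ContDiff Topology
open Set Function Literature.Topology.FourManifolds SphereFourSplitting

namespace Summit.SmoothPoincare4.SmoothPoincare4.Cruxes.RungOne.Sketch

/-! ### Coordinate calculus -/

/-- `√(1/2)⁻¹ = √2`. [folklore] -/
theorem inv_sqrt_half : (Real.sqrt (1 / 2))⁻¹ = Real.sqrt 2 := by
  rw [one_div, Real.sqrt_inv, inv_inv]

/-- `√2 · (√2)⁻¹ · x = x`. [folklore] -/
theorem sqrt_two_mul_inv_mul (x : ℝ) : Real.sqrt 2 * (Real.sqrt 2)⁻¹ * x = x := by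
  rw [mul_inv_cancel₀ (Real.sqrt_ne_zero'.2 two_pos), one_mul]

/-- **Polar coordinates on `V₀`**: the head `y = (x₀, x₁, x₂)`, the tail `w = (x₃, x₄)` and the
unit tail `w/|w| ∈ 𝕊¹` (`|w|² = x₃² + x₄² ≥ 1/2 > 0` on `V₀`) as smooth maps on the polar tube.
[folklore] -/
theorem exists_polarTube_coords :
    ∃ (yv : PolarTube → EuclideanSpace ℝ (Fin 3)) (wv : PolarTube → EuclideanSpace ℝ (Fin 2))
      (uq : PolarTube → Metric.sphere (0 : EuclideanSpace ℝ (Fin 2)) 1),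
      ContMDiff (𝓡∂ 4) 𝓘(ℝ, EuclideanSpace ℝ (Fin 3)) ∞ yv ∧
      ContMDiff (𝓡∂ 4) 𝓘(ℝ, EuclideanSpace ℝ (Fin 2)) ∞ wv ∧
      ContMDiff (𝓡∂ 4) (𝓡 1) ∞ uq ∧
      (∀ q, yv q 0 = ι (ιV q) 0 ∧ yv q 1 = ι (ιV q) 1 ∧ yv q 2 = ι (ιV q) 2) ∧
      (∀ q, wv q 0 = ι (ιV q) 3 ∧ wv q 1 = ι (ιV q) 4) ∧
      (∀ q, (uq q : EuclideanSpace ℝ (Fin 2)) = (Real.sqrt (tubeFn (ι (ιV q))))⁻¹ • wv q) := by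
  haveI := fact_finrank_euclideanSpace_succ 1
  have hp : ContMDiff (𝓡∂ 4) 𝓘(ℝ, EuclideanSpace ℝ (Fin 5)) ∞ fun q : PolarTube => ι (ιV q) :=
    contMDiff_ι_ιV
  have hpi : ∀ i, ContMDiff (𝓡∂ 4) 𝓘(ℝ, ℝ) ∞ fun q : PolarTube => ι (ιV q) i := fun i =>
    (EuclideanSpace.proj i).contDiff.comp_contMDiff hp
  set yv : PolarTube → EuclideanSpace ℝ (Fin 3) := fun q =>
    (EuclideanSpace.equiv (Fin 3) ℝ).symm ![ι (ιV q) 0, ι (ιV q) 1, ι (ιV q) 2] with hyv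
  set wv : PolarTube → EuclideanSpace ℝ (Fin 2) := fun q =>
    (EuclideanSpace.equiv (Fin 2) ℝ).symm ![ι (ιV q) 3, ι (ιV q) 4] with hwv
  have hyvs : ContMDiff (𝓡∂ 4) 𝓘(ℝ, EuclideanSpace ℝ (Fin 3)) ∞ yv := by
    refine contMDiff_euclidean_of_coord fun i => ?_
    fin_cases i
    · exact hpi 0
    · exact hpi 1
    · exact hpi 2
  have hwvs : ContMDiff (𝓡∂ 4) 𝓘(ℝ, EuclideanSpace ℝ (Fin 2)) ∞ wv := by
    refine contMDiff_euclidean_of_coord fun i => ?_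
    fin_cases i
    · exact hpi 3
    · exact hpi 4
  have htpos : ∀ q : PolarTube, 0 < tubeFn (ι (ιV q)) := fun q =>
    lt_of_lt_of_le (by norm_num) (half_le_tubeS_ιV q)
  have hwn : ∀ q, ‖wv q‖ = Real.sqrt (tubeFn (ι (ιV q))) := by
    intro q
    rw [← Real.sqrt_sq (norm_nonneg _), ← sq2_eq_norm_sq]
    rfl
  have hν : ContMDiff (𝓡∂ 4) 𝓘(ℝ, ℝ) ∞ fun q : PolarTube => (Real.sqrt (tubeFn (ι (ιV q))))⁻¹ := by
    intro q
    have h1 : ContMDiffAt (𝓡∂ 4) 𝓘(ℝ, ℝ) ∞ (fun q : PolarTube => tubeFn (ι (ιV q))) q :=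
      (contDiff_tubeFn.comp_contMDiff hp) q
    have h2 : ContMDiffAt (𝓡∂ 4) 𝓘(ℝ, ℝ) ∞ (fun q : PolarTube => Real.sqrt (tubeFn (ι (ιV q)))) q :=
      ContDiffAt.comp_contMDiffAt (f := fun q : PolarTube => tubeFn (ι (ιV q))) (x := q)
        (Real.contDiffAt_sqrt (htpos q).ne') h1
    exact ContDiffAt.comp_contMDiffAt (f := fun q : PolarTube => Real.sqrt (tubeFn (ι (ιV q)))) (x := q)
      (contDiffAt_inv ℝ (Real.sqrt_pos.2 (htpos q)).ne') h2
  have humem : ∀ q : PolarTube, (Real.sqrt (tubeFn (ι (ιV q))))⁻¹ • wv q ∈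
      Metric.sphere (0 : EuclideanSpace ℝ (Fin 2)) 1 := by
    intro q
    rw [mem_sphere_zero_iff_norm, norm_smul, norm_inv, Real.norm_eq_abs,
      abs_of_nonneg (Real.sqrt_nonneg _), hwn, inv_mul_cancel₀ (Real.sqrt_pos.2 (htpos q)).ne']
  refine ⟨yv, wv, Set.codRestrict _ _ humem, hyvs, hwvs, ?_, fun q => ⟨rfl, rfl, rfl⟩,
    fun q => ⟨rfl, rfl⟩, fun q => rfl⟩
  exact (contDiff_smul.comp_contMDiff (hν.prodMk_space hwvs)).codRestrict_sphere _

/-! ### The extension over the polar tube and the re-gluing of the level sphere -/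

/-- **Registered helper `helper_sliceRec_reglue`: a circle of isometries extends over the polar
tube, so the level sphere is the gluing of the two tubes along the suspension of
`u ↦ A(angA u) ∘ L|S²`.**  For a smooth loop `A` of linear isometries of `ℝ³` with `A(a) = 1`
for `a ∉ (1/4, 3/4)`, an isometry `L`, and a diffeomorphism `χ : ∂W₀ ≅ ∂V₀` with
`θ(χ z) = A(angA u) L θ(z)`, `w(χ z) = w(z)` (`u = √2 w(z)`): the map
`Θ(y, w) = (L⁻¹ A(angA (w/|w|))⁻¹ y, w)` is a self-diffeomorphism of `V₀` (smooth by
`contMDiff_comp_angA` and Lee 2013, Cor. 5.30; it preserves `Σ xᵢ²` and `x₃, x₄`), it restricts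
to a bijection `ψ` of `∂V₀` with `ψ (χ z) = z` (the identity `∂W₀ ≡ ∂V₀`), hence
`S = W₀ ∪_{id} V₀` (`isBoundaryGluing_levelSphere`) is also `W₀ ∪_χ V₀`
(`IsBoundaryGluing.comp_diffeomorph_right`, Hirsch 1976, Ch. 8 §2, Thm. 2.2).
[cite: HirschDT1976, Ch. 8 §2, Thm. 2.2] -/
theorem helper_sliceRec_reglue : ∀ (A : ℝ → (EuclideanSpace ℝ (Fin 3) ≃ₗᵢ[ℝ] EuclideanSpace ℝ (Fin 3))), ContDiff ℝ ∞ (fun t => (A t : EuclideanSpace ℝ (Fin 3) →L[ℝ] EuclideanSpace ℝ (Fin 3))) → (∀ t, t ≤ 1 / 4 ∨ 3 / 4 ≤ t → A t = LinearIsometryEquiv.refl ℝ (EuclideanSpace ℝ (Fin 3))) → ∀ (L : EuclideanSpace ℝ (Fin 3) ≃ₗᵢ[ℝ] EuclideanSpace ℝ (Fin 3)) (χ : (𝓡∂ 4).boundary EquatorTube ≃ₘ⟮𝓡 3, 𝓡 3⟯ (𝓡∂ 4).boundary PolarTube), (∀ z : (𝓡∂ 4).boundary EquatorTube, invTail ((RegularSublevel.splitDiffeomorph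 isRegularLevel_tubeS).symm (χ z)).1 = invTail z.1 ∧ ∀ u : Metric.sphere (0 : EuclideanSpace ℝ (Fin 2)) 1, (u : EuclideanSpace ℝ (Fin 2)) = Real.sqrt 2 • invTail z.1 → invHead ((RegularSublevel.splitDiffeomorph isRegularLevel_tubeS).symm (χ z)).1 = sphereCongr (A (angA u)) (sphereCongr L (invHead z.1))) → IsBoundaryGluing (RegularSublevel.boundaryData isRegularLevel_tubeS) (RegularSublevel.boundaryData hPolar) χ (𝓡 4) LevelSphere := by
  intro A hA hAflat L χ hχ
  haveI := fact_finrank_euclideanSpace_succ 1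
  haveI := fact_finrank_euclideanSpace_succ 2
  obtain ⟨yv, wv, uq, hyvs, hwvs, huqs, hyv, hwv, huq⟩ := exists_polarTube_coords
  have hp : ContMDiff (𝓡∂ 4) 𝓘(ℝ, EuclideanSpace ℝ (Fin 5)) ∞ fun q : PolarTube => ι (ιV q) :=
    contMDiff_ι_ιV
  have hpi : ∀ i, ContMDiff (𝓡∂ 4) 𝓘(ℝ, ℝ) ∞ fun q : PolarTube => ι (ιV q) i := fun i =>
    (EuclideanSpace.proj i).contDiff.comp_contMDiff hp
  -- the isometry families as smooth maps on `ℝ × ℝ³`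
  have hAcl : ContDiff ℝ ∞ fun p : ℝ × EuclideanSpace ℝ (Fin 3) => A p.1 p.2 :=
    (hA.comp contDiff_fst).clm_apply contDiff_snd
  have hAcl' : ContDiff ℝ ∞ fun p : ℝ × EuclideanSpace ℝ (Fin 3) => (A p.1).symm p.2 :=
    ((contDiff_linearIsometryEquiv_symm hA).comp contDiff_fst).clm_apply contDiff_snd
  have hA0 : A 0 = LinearIsometryEquiv.refl ℝ (EuclideanSpace ℝ (Fin 3)) := hAflat 0 (Or.inl (by norm_num))
  -- the two fibre maps `y ↦ L⁻¹ A(a)⁻¹ y`, `y ↦ A(a) L y`, smooth by descent to the circle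
  have hMf : ContMDiff (𝓡∂ 4) 𝓘(ℝ, EuclideanSpace ℝ (Fin 3)) ∞
      fun q : PolarTube => L.symm ((A (angA (uq q))).symm (yv q)) := by
    have hK : ContMDiff (𝓘(ℝ, ℝ).prod (𝓡∂ 4)) 𝓘(ℝ, EuclideanSpace ℝ (Fin 3)) ∞
        fun p : ℝ × PolarTube => L.symm ((A p.1).symm (yv p.2)) :=
      L.symm.contDiff.comp_contMDiff
        (hAcl'.comp_contMDiff (contMDiff_fst.prodMk_space (hyvs.comp contMDiff_snd)))
    refine contMDiff_comp_angA (fun s (q : PolarTube) => L.symm ((A s).symm (yv q))) uq hK ?_ huqs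
    intro s hs q
    show L.symm ((A s).symm (yv q)) = L.symm ((A 0).symm (yv q))
    rw [hAflat s hs, hA0]
  have hMg : ContMDiff (𝓡∂ 4) 𝓘(ℝ, EuclideanSpace ℝ (Fin 3)) ∞
      fun q : PolarTube => A (angA (uq q)) (L (yv q)) := by
    have hK : ContMDiff (𝓘(ℝ, ℝ).prod (𝓡∂ 4)) 𝓘(ℝ, EuclideanSpace ℝ (Fin 3)) ∞
        fun p : ℝ × PolarTube => A p.1 (L (yv p.2)) :=
      hAcl.comp_contMDiff (contMDiff_fst.prodMk_space (L.contDiff.comp_contMDiff (hyvs.comp contMDiff_snd)))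
    refine contMDiff_comp_angA (fun s (q : PolarTube) => A s (L (yv q))) uq hK ?_ huqs
    intro s hs q
    show A s (L (yv q)) = A 0 (L (yv q))
    rw [hAflat s hs, hA0]
  -- the ambient maps `V₀ → ℝ⁵`
  have hsum : ∀ (M : PolarTube → EuclideanSpace ℝ (Fin 3)),
      ContMDiff (𝓡∂ 4) 𝓘(ℝ, EuclideanSpace ℝ (Fin 3)) ∞ M → (∀ q, ‖M q‖ = ‖yv q‖) →
      ∃ f : PolarTube → EuclideanSpace ℝ (Fin 5),
        ContMDiff (𝓡∂ 4) 𝓘(ℝ, EuclideanSpace ℝ (Fin 5)) ∞ f ∧ (∀ q, sqNorm (f q) = 1) ∧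
        (∀ q, tubeFn (f q) = tubeFn (ι (ιV q))) ∧
        ∀ q, f q 0 = M q 0 ∧ f q 1 = M q 1 ∧ f q 2 = M q 2 ∧ f q 3 = ι (ιV q) 3 ∧ f q 4 = ι (ιV q) 4 := by
    intro M hM hMn
    refine ⟨fun q => (EuclideanSpace.equiv (Fin 5) ℝ).symm ![M q 0, M q 1, M q 2, ι (ιV q) 3, ι (ιV q) 4],
      ?_, fun q => ?_, fun q => rfl, fun q => ⟨rfl, rfl, rfl, rfl, rfl⟩⟩
    · refine contMDiff_euclidean_of_coord fun i => ?_
      fin_cases i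
      · exact (EuclideanSpace.proj (0 : Fin 3)).contDiff.comp_contMDiff hM
      · exact (EuclideanSpace.proj (1 : Fin 3)).contDiff.comp_contMDiff hM
      · exact (EuclideanSpace.proj (2 : Fin 3)).contDiff.comp_contMDiff hM
      · exact hpi 3
      · exact hpi 4
    · have hS := sqNorm_ι (ιV q)
      have h3 : ∀ y : EuclideanSpace ℝ (Fin 3), ‖y‖ ^ 2 = y 0 ^ 2 + y 1 ^ 2 + y 2 ^ 2 := by
        intro y
        rw [EuclideanSpace.norm_sq_eq, Fin.sum_univ_three]
        simp [Real.norm_eq_abs, sq_abs]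
      have h1 := h3 (M q)
      have h2 := h3 (yv q)
      obtain ⟨y0, y1, y2⟩ := hyv q
      rw [hMn q, h2, y0, y1, y2] at h1
      simp only [sqNorm] at hS ⊢
      show M q 0 ^ 2 + M q 1 ^ 2 + M q 2 ^ 2 + ι (ιV q) 3 ^ 2 + ι (ιV q) 4 ^ 2 = 1
      linarith
  obtain ⟨fΘ, hfΘs, hfΘ1, hfΘt, hfΘ⟩ := hsum _ hMf (fun q => by
    rw [LinearIsometryEquiv.norm_map, LinearIsometryEquiv.norm_map])
  obtain ⟨gΘ, hgΘs, hgΘ1, hgΘt, hgΘ⟩ := hsum _ hMg (fun q => by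
    rw [LinearIsometryEquiv.norm_map, LinearIsometryEquiv.norm_map])
  obtain ⟨Θf, hΘfs, hΘf⟩ := exists_lift_polarTube fΘ hfΘs hfΘ1 (fun q => by
    rw [hfΘt]; exact half_le_tubeS_ιV q)
  obtain ⟨Θg, hΘgs, hΘg⟩ := exists_lift_polarTube gΘ hgΘs hgΘ1 (fun q => by
    rw [hgΘt]; exact half_le_tubeS_ιV q)
  -- coordinates after applying the maps
  have hwv_of : ∀ q q' : PolarTube, ι (ιV q') 3 = ι (ιV q) 3 → ι (ιV q') 4 = ι (ιV q) 4 →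
      wv q' = wv q ∧ uq q' = uq q := by
    intro q q' h3 h4
    have hw : wv q' = wv q := by
      ext i
      fin_cases i
      · show wv q' 0 = wv q 0
        rw [(hwv q').1, (hwv q).1, h3]
      · show wv q' 1 = wv q 1
        rw [(hwv q').2, (hwv q).2, h4]
    have ht : tubeFn (ι (ιV q')) = tubeFn (ι (ιV q)) := by simp only [tubeFn, h3, h4]
    exact ⟨hw, Subtype.ext (by rw [huq, huq, hw, ht])⟩
  have hyv_ext : ∀ (q : PolarTube) (v : EuclideanSpace ℝ (Fin 3)),
      ι (ιV q) 0 = v 0 → ι (ιV q) 1 = v 1 → ι (ιV q) 2 = v 2 → yv q = v := by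
    intro q v h0 h1 h2
    ext i
    fin_cases i
    · show yv q 0 = v 0
      rw [(hyv q).1, h0]
    · show yv q 1 = v 1
      rw [(hyv q).2.1, h1]
    · show yv q 2 = v 2
      rw [(hyv q).2.2, h2]
  have hp_ext : ∀ (q : PolarTube) (v : EuclideanSpace ℝ (Fin 5)),
      v 0 = ι (ιV q) 0 → v 1 = ι (ιV q) 1 → v 2 = ι (ιV q) 2 → v 3 = ι (ιV q) 3 →
      v 4 = ι (ιV q) 4 → v = ι (ιV q) := by
    intro q v h0 h1 h2 h3 h4
    ext i
    fin_cases i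
    exacts [h0, h1, h2, h3, h4]
  -- `Θg ∘ Θf = id` and `Θf ∘ Θg = id`
  have hleft : ∀ q, Θg (Θf q) = q := by
    intro q
    obtain ⟨e0, e1, e2, e3, e4⟩ := hfΘ q
    have hq' : ι (ιV (Θf q)) = fΘ q := hΘf q
    obtain ⟨hw, hu⟩ := hwv_of q (Θf q) (by rw [hq', e3]) (by rw [hq', e4])
    have hy : yv (Θf q) = L.symm ((A (angA (uq q))).symm (yv q)) :=
      hyv_ext _ _ (by rw [hq', e0]) (by rw [hq', e1]) (by rw [hq', e2])
    apply polarTube_ext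
    rw [hΘg]
    obtain ⟨f0, f1, f2, f3, f4⟩ := hgΘ (Θf q)
    have hM : A (angA (uq (Θf q))) (L (yv (Θf q))) = yv q := by
      rw [hu, hy, LinearIsometryEquiv.apply_symm_apply, LinearIsometryEquiv.apply_symm_apply]
    refine hp_ext q _ ?_ ?_ ?_ ?_ ?_
    · rw [f0, hM, (hyv q).1]
    · rw [f1, hM, (hyv q).2.1]
    · rw [f2, hM, (hyv q).2.2]
    · rw [f3, hq', e3]
    · rw [f4, hq', e4]
  have hright : ∀ q, Θf (Θg q) = q := by
    intro q
    obtain ⟨e0, e1, e2, e3, e4⟩ := hgΘ q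
    have hq' : ι (ιV (Θg q)) = gΘ q := hΘg q
    obtain ⟨hw, hu⟩ := hwv_of q (Θg q) (by rw [hq', e3]) (by rw [hq', e4])
    have hy : yv (Θg q) = A (angA (uq q)) (L (yv q)) :=
      hyv_ext _ _ (by rw [hq', e0]) (by rw [hq', e1]) (by rw [hq', e2])
    apply polarTube_ext
    rw [hΘf]
    obtain ⟨f0, f1, f2, f3, f4⟩ := hfΘ (Θg q)
    have hM : L.symm ((A (angA (uq (Θg q)))).symm (yv (Θg q))) = yv q := by
      rw [hu, hy, LinearIsometryEquiv.symm_apply_apply, LinearIsometryEquiv.symm_apply_apply]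
    refine hp_ext q _ ?_ ?_ ?_ ?_ ?_
    · rw [f0, hM, (hyv q).1]
    · rw [f1, hM, (hyv q).2.1]
    · rw [f2, hM, (hyv q).2.2]
    · rw [f3, hq', e3]
    · rw [f4, hq', e4]
  -- the diffeomorphism `Θ` of `V₀` and its boundary restriction `ψ`
  set Θ : PolarTube ≃ₘ⟮𝓡∂ 4, 𝓡∂ 4⟯ PolarTube := ⟨⟨Θf, Θg, hleft, hright⟩, hΘfs, hΘgs⟩ with hΘdef
  have hbdf : ∀ z : (𝓡∂ 4).boundary PolarTube, Θf z.1 ∈ (𝓡∂ 4).boundary PolarTube := by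
    intro z
    rw [mem_boundary_polarTube_iff, hΘf, hfΘt]
    exact (mem_boundary_polarTube_iff z.1).1 z.2
  have hbdg : ∀ z : (𝓡∂ 4).boundary PolarTube, Θg z.1 ∈ (𝓡∂ 4).boundary PolarTube := by
    intro z
    rw [mem_boundary_polarTube_iff, hΘg, hgΘt]
    exact (mem_boundary_polarTube_iff z.1).1 z.2
  set ψ : (𝓡∂ 4).boundary PolarTube ≃ (𝓡∂ 4).boundary PolarTube :=
    ⟨fun z => ⟨Θf z.1, hbdf z⟩, fun z => ⟨Θg z.1, hbdg z⟩, fun z => Subtype.ext (hleft z.1),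
      fun z => Subtype.ext (hright z.1)⟩ with hψdef
  have hΦ : ∀ w : (𝓡∂ 4).boundary PolarTube,
      Θ ((RegularSublevel.boundaryData hPolar).incl w) = (RegularSublevel.boundaryData hPolar).incl (ψ w) :=
    fun w => rfl
  refine isBoundaryGluing_levelSphere.comp_diffeomorph_right Θ ψ hΦ fun z => ?_
  -- `ψ (χ z) = z` on points
  apply Subtype.ext
  apply polarTube_ext
  show ι (ιV (Θf (χ z).1)) = ι (ιV (RegularSublevel.splitDiffeomorph isRegularLevel_tubeS z).1)
  rw [hΘf]
  -- the coordinates of `χ z` and of `z`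
  set q : PolarTube := (χ z).1 with hqdef
  obtain ⟨hbw, hsc⟩ := ι_boundaryW ((RegularSublevel.splitDiffeomorph isRegularLevel_tubeS).symm (χ z))
  obtain ⟨hbz, hscz⟩ := ι_boundaryW z
  have hpq : ι (ιV q) = ι (ιW ((RegularSublevel.splitDiffeomorph isRegularLevel_tubeS).symm (χ z)).1) := rfl
  obtain ⟨htail, hhead⟩ := hχ z
  have htq : tubeFn (ι (ιV q)) = 1 / 2 := (mem_boundary_polarTube_iff q).1 (χ z).2
  have hwq : wv q = invTail z.1 := by
    ext i
    fin_cases i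
    · show wv q 0 = invTail z.1 0
      rw [(hwv q).1, hpq, hbw, tubeParam_apply_three]
      dsimp only
      rw [hsc, htail]
      exact sqrt_two_mul_inv_mul _
    · show wv q 1 = invTail z.1 1
      rw [(hwv q).2, hpq, hbw, tubeParam_apply_four]
      dsimp only
      rw [hsc, htail]
      exact sqrt_two_mul_inv_mul _
  have huq' : (uq q : EuclideanSpace ℝ (Fin 2)) = Real.sqrt 2 • invTail z.1 := by
    rw [huq, htq, inv_sqrt_half, hwq]
  have hhd := hhead (uq q) huq'
  -- the head of `χ z` as a vector
  have hyq : yv q = (Real.sqrt 2)⁻¹ • (A (angA (uq q)) (L ((invHead z.1 : Metric.sphere (0 : EuclideanSpace ℝ (Fin 3)) 1) : EuclideanSpace ℝ (Fin 3)))) := by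
    refine hyv_ext q _ ?_ ?_ ?_
    · rw [hpq, hbw, tubeParam_apply_zero]
      dsimp only
      rw [hhd, hsc, coe_sphereCongr, coe_sphereCongr, PiLp.smul_apply, smul_eq_mul]
    · rw [hpq, hbw, tubeParam_apply_one]
      dsimp only
      rw [hhd, hsc, coe_sphereCongr, coe_sphereCongr, PiLp.smul_apply, smul_eq_mul]
    · rw [hpq, hbw, tubeParam_apply_two]
      dsimp only
      rw [hhd, hsc, coe_sphereCongr, coe_sphereCongr, PiLp.smul_apply, smul_eq_mul]
  have hMq : L.symm ((A (angA (uq q))).symm (yv q)) =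
      (Real.sqrt 2)⁻¹ • ((invHead z.1 : Metric.sphere (0 : EuclideanSpace ℝ (Fin 3)) 1) : EuclideanSpace ℝ (Fin 3)) := by
    rw [hyq, LinearIsometryEquiv.map_smul, LinearIsometryEquiv.map_smul,
      LinearIsometryEquiv.symm_apply_apply, LinearIsometryEquiv.symm_apply_apply]
  obtain ⟨f0, f1, f2, f3, f4⟩ := hfΘ q
  have g0 : fΘ q 0 = ι (ιW z.1) 0 := by
    rw [f0, hMq, hbz, tubeParam_apply_zero]
    dsimp only
    rw [hscz, PiLp.smul_apply, smul_eq_mul]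
  have g1 : fΘ q 1 = ι (ιW z.1) 1 := by
    rw [f1, hMq, hbz, tubeParam_apply_one]
    dsimp only
    rw [hscz, PiLp.smul_apply, smul_eq_mul]
  have g2 : fΘ q 2 = ι (ιW z.1) 2 := by
    rw [f2, hMq, hbz, tubeParam_apply_two]
    dsimp only
    rw [hscz, PiLp.smul_apply, smul_eq_mul]
  have g3 : fΘ q 3 = ι (ιW z.1) 3 := by
    rw [f3, hbz, tubeParam_apply_three]
    dsimp only
    rw [hscz, sqrt_two_mul_inv_mul, ← (hwv q).1, hwq]
  have g4 : fΘ q 4 = ι (ιW z.1) 4 := by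
    rw [f4, hbz, tubeParam_apply_four]
    dsimp only
    rw [hscz, sqrt_two_mul_inv_mul, ← (hwv q).2, hwq]
  show fΘ q = ι (ιW z.1)
  ext i
  fin_cases i
  exacts [g0, g1, g2, g3, g4]

end Summit.SmoothPoincare4.SmoothPoincare4.Cruxes.RungOne.Sketch

end
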